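import Mathlib.LinearAlgebra.Matrix.Rank
import Mathlib.Algebra.Field.ZMod
import Literature.Computability.Complexity.PolynomialEntropyApproximation
import Literature.Computability.Complexity.GaussRankList
import Literature.Computability.Complexity.CodeFP
import HarnessLib

/-!
# Polynomial Entropy Approximation in degree `1`, II: the rank algorithm on untyped instances

Towards `PEA 1 ∈ PromiseP` (the base of the degree dial of route PneNP/SzkEntropy; DGRV §1 p. 1:
"for degree 1 the entropy is determined by the rank, computable in polynomial time").  The
decision procedure reads an instance `(n, P, k)` of `PEA` — `P` a sparse map given as nested lists
of variable indices — checks the syntactic degree bound `DegLE 1`, computes the `F₂`-rank of the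
linear part of `P` RESTRICTED TO THE OCCURRING VARIABLES (the number `n` of variables is given in
binary, so the full `m × n` coefficient matrix may be exponentially wide and is never written down),
and accepts iff `k + 1 ≤ rank`.  This file fixes that procedure as plain functions on the UNTYPED
presentation `ℕ × List (List (List ℕ)) × ℕ` of instances (variable indices as naturals) and proves
it correct; its polynomial running time (typed `CodeFP` algebra) and the membership `PEA 1 ∈ PromiseP`
are the sequel.

* `PEAInst.untyped`, `PEAInst.untypedCode`, `PEAInst.encode_eq_untypedCode` — forgetting the `Fin n`
  typing of indices does not change the Boolean code (`sigmaBool / listBool³ / pairBool` =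
  `pairE natE (pairE (listE³ natE) natE)`);
* `PEADegOne.vars/rows/rank/degOK/decideFn` — the procedure: `vars P = P.flatten.flatten` (all
  variable occurrences, duplicates allowed), `rows P` = for each output polynomial the parities of
  the multiplicities of the monomials `[v]`, `v ∈ vars P`, `rank` = `GaussRank.lrank` of these rows;
* `PEADegOne.degOK_untyped_iff` — `degOK` decides `DegLE 1`;
* `PEADegOne.rank_untyped_eq` — **the computed rank is the rank of the linear-part matrix**
  `(#{[j] in Pᵢ} mod 2)ᵢⱼ` of `PolynomialEntropyApproximationAffine.lean`: restricting to the
  occurring columns (with repetitions) is injective on the row space.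

## References

* Z. Dvir, D. Gutfreund, G. N. Rothblum, S. Vadhan, *On approximating the entropy of polynomial
  mappings*, ICS 2011 (ECCC TR10-160), §1 p. 1.  bib `DvirGutfreundRothblumVadhan2010`.
* S. Arora, B. Barak, *Computational Complexity: A Modern Approach*, CUP 2009, §0.1 (codes).
-/

namespace Literature.Computability.Complexity

open _root_.Computability CodeFP

/-! ### Untyped presentation of `PEA` instances -/

namespace PEAInst

/-- The untyped presentation of a `PEA` instance `(n, P, k)`: variable indices `Fin n` replaced by
their values. [folklore] -/
def untyped (I : PEAInst) : ℕ × (List (List (List ℕ)) × ℕ) :=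
  (I.1, I.2.1.map (List.map (List.map Fin.val)), I.2.2)

/-- The Boolean code of untyped instances: `n` and `k` in binary, the map as three nested headed
lists of binary numerals (the `CodeFP` spelling of `PEAInst.encoding`). [cite: AroraBarak2009, §0.1] -/
def untypedCode : ℕ × (List (List (List ℕ)) × ℕ) → List Bool :=
  pairE natE (pairE (listE (listE (listE natE))) natE)

/-- `listE` commutes with re-coding the items along a map. [folklore] -/
theorem listE_comp_map {α β : Type} (e : β → List Bool) (h : α → β) :
    listE (e ∘ h) = listE e ∘ List.map h := by
  funext l
  simp [listE, rawE, List.map_map]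

/-- **Forgetting the `Fin` typing does not change the code**: the route's encoding of a `PEA`
instance is the untyped code of its untyped presentation. [cite: AroraBarak2009, §0.1] -/
theorem encode_eq_untypedCode (I : PEAInst) :
    PEAInst.encoding.encode I = untypedCode (untyped I) := by
  obtain ⟨n, P, k⟩ := I
  have hfin : ((encodingFinBool n).encode : Fin n → List Bool) = natE ∘ Fin.val := rfl
  have h3 : ((PolyMapF2.encoding n).encode : PolyMapF2 n → List Bool) =
      listE (listE (listE natE)) ∘ List.map (List.map (List.map Fin.val)) := by
    rw [PolyMapF2.encoding, listE_eq, listE_eq, listE_eq, hfin, listE_comp_map,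
      listE_comp_map, listE_comp_map]
  change boolPair (encodeNat n) (boolPair ((PolyMapF2.encoding n).encode P) (encodeNat k)) = _
  rw [h3]
  rfl

/-- Components of the untyped presentation. [folklore] -/
@[simp] theorem untyped_fst (I : PEAInst) : (untyped I).1 = I.1 := rfl

/-- Components of the untyped presentation. [folklore] -/
@[simp] theorem untyped_snd_fst (I : PEAInst) :
    (untyped I).2.1 = I.2.1.map (List.map (List.map Fin.val)) := rfl

/-- Components of the untyped presentation. [folklore] -/
@[simp] theorem untyped_snd_snd (I : PEAInst) : (untyped I).2.2 = I.2.2 := rfl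

end PEAInst

/-! ### The degree-`1` procedure on untyped maps -/

namespace PEADegOne

/-- All variable occurrences of an untyped sparse map, in order, with repetitions
(`P.flatten.flatten`); for a degree-`≤ 1` map these are exactly the indices `v` of its linear
monomials `[v]`. [folklore] -/
def vars (P : List (List (List ℕ))) : List ℕ :=
  P.flatten.flatten

/-- The rows of the linear-part matrix restricted to the occurring variables: row `i`, column `t`
is the parity of the multiplicity of the monomial `[vars P[t]]` in the output polynomial `Pᵢ`.
[DvirGutfreundRothblumVadhan2010, §1 p. 1] [cite: DvirGutfreundRothblumVadhan2010, §1 p.1] -/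
def rows (P : List (List (List ℕ))) : List (List (ZMod 2)) :=
  P.map fun p => (vars P).map fun v => ((p.count [v] : ℕ) : ZMod 2)

/-- The `F₂`-rank of the restricted linear-part matrix, by the list Gaussian elimination
`GaussRank.lrank`. [DvirGutfreundRothblumVadhan2010, §1 p. 1] [cite: DvirGutfreundRothblumVadhan2010, §1 p.1] -/
def rank (P : List (List (List ℕ))) : ℕ :=
  GaussRank.lrank (vars P).length (rows P)

/-- The syntactic degree test: every monomial lists at most one variable. [folklore] -/
def degOK (P : List (List (List ℕ))) : Bool :=
  P.all fun p => p.all fun μ => decide (μ.length ≤ 1)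

/-- **The degree-`1` decision procedure for `PEA`** on untyped instances `(n, P, k)`: accept iff
`P` has syntactic degree `≤ 1` and `k + 1 ≤ rank_{F₂}` of its linear part.
[DvirGutfreundRothblumVadhan2010, §1 p. 1] [cite: DvirGutfreundRothblumVadhan2010, §1 p.1] -/
def decideFn (t : ℕ × (List (List (List ℕ)) × ℕ)) : Bool :=
  degOK t.2.1 && decide (t.2.2 + 1 ≤ rank t.2.1)

variable {n : ℕ}

/-- `degOK` decides the syntactic degree bound `DegLE 1` (lengths of monomials are unchanged by
forgetting the `Fin` typing). [folklore] -/
theorem degOK_untyped_iff (P : PolyMapF2 n) :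
    degOK (P.map (List.map (List.map Fin.val))) = true ↔ P.DegLE 1 := by
  simp only [degOK, List.all_eq_true, List.mem_map, decide_eq_true_eq, PolyMapF2.DegLE,
    forall_exists_index, and_imp, forall_apply_eq_imp_iff₂, List.length_map]

/-- Every row of `rows P` has length `|vars P|`. [folklore] -/
theorem length_of_mem_rows {P : List (List (List ℕ))} {r : List (ZMod 2)} (hr : r ∈ rows P) :
    r.length = (vars P).length := by
  obtain ⟨p, -, rfl⟩ := List.mem_map.1 hr
  exact List.length_map _

/-- `rows P` has one row per output polynomial. [folklore] -/
@[simp] theorem length_rows (P : List (List (List ℕ))) : (rows P).length = P.length :=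
  List.length_map _

/-- The variable occurrences of the untyped presentation of `P : PolyMapF2 n` are `< n`. [folklore] -/
theorem vars_lt {P : PolyMapF2 n} {v : ℕ} (hv : v ∈ vars (P.map (List.map (List.map Fin.val)))) :
    v < n := by
  simp only [vars, List.mem_flatten, List.mem_map] at hv
  obtain ⟨μ', ⟨p', ⟨p, -, rfl⟩, hμ'⟩, hvμ⟩ := hv
  obtain ⟨μ, -, rfl⟩ := List.mem_map.1 hμ'
  obtain ⟨j, -, rfl⟩ := List.mem_map.1 hvμ
  exact j.isLt

/-- A variable of a linear monomial `[j]` of `Pᵢ` occurs in `vars` of the untyped presentation.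
[folklore] -/
theorem val_mem_vars {P : PolyMapF2 n} {i : Fin P.length} {j : Fin n} (h : [j] ∈ P.get i) :
    j.val ∈ vars (P.map (List.map (List.map Fin.val))) := by
  simp only [vars, List.mem_flatten, List.mem_map]
  refine ⟨[j.val], ⟨(P.get i).map (List.map Fin.val), ⟨P.get i, List.get_mem P i, rfl⟩, ?_⟩, by simp⟩
  exact List.mem_map.2 ⟨[j], h, rfl⟩

/-- Entries of `rows` of the untyped presentation: row `i`, column `t` is the parity of the
multiplicity of `[vars[t]]` in `Pᵢ`, i.e. the `(i, vars[t])` entry of the linear-part matrix.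
[folklore] -/
theorem getD_getD_rows (P : PolyMapF2 n) (i : Fin P.length) {t : ℕ}
    (ht : t < (vars (P.map (List.map (List.map Fin.val)))).length) (j : Fin n)
    (hj : (vars (P.map (List.map (List.map Fin.val)))).get ⟨t, ht⟩ = j.val) :
    ((rows (P.map (List.map (List.map Fin.val)))).getD i []).getD t 0 =
      (((P.get i).count [j] : ℕ) : ZMod 2) := by
  set PT := P.map (List.map (List.map Fin.val)) with hPT
  have hi : (i : ℕ) < (rows PT).length := by simp [hPT]
  rw [List.getD_eq_getElem _ _ hi]
  simp only [rows, List.getElem_map]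
  rw [List.getD_eq_getElem _ _ (by simp [ht]), List.getElem_map]
  have hget : (vars PT)[t] = j.val := hj
  rw [hget]
  have hPi : PT[(i : ℕ)]'(by simp [hPT]) = (P.get i).map (List.map Fin.val) := by
    simp [hPT]
  rw [hPi]
  have hinj : Function.Injective (List.map Fin.val : List (Fin n) → List ℕ) :=
    List.map_injective_iff.2 Fin.val_injective
  have : ([j.val] : List ℕ) = List.map Fin.val [j] := rfl
  rw [this, List.count_map_of_injective _ _ hinj]

/-! ### The computed rank is the rank of the linear-part matrix -/

/-- A linear map that kills no nonzero vector of a subspace `S` preserves its dimension: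
`dim (φ S) = dim S`. [folklore] -/
theorem finrank_map_eq_of_forall_eq_zero {K V W : Type*} [Field K] [AddCommGroup V] [Module K V]
    [AddCommGroup W] [Module K W] (φ : V →ₗ[K] W) (S : Submodule K V)
    (h : ∀ x ∈ S, φ x = 0 → x = 0) : Module.finrank K (S.map φ) = Module.finrank K S := by
  have hinj : Function.Injective (φ.comp S.subtype) := by
    intro x y hxy
    have hsub : φ (x - y : S) = 0 := by
      simp only [LinearMap.coe_comp, Function.comp_apply, Submodule.coe_subtype] at hxy
      rw [Submodule.coe_sub, map_sub, hxy, sub_self]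
    have := h _ (x - y).2 hsub
    exact sub_eq_zero.1 (by exact_mod_cast this)
  rw [← LinearMap.finrank_range_of_inj hinj, LinearMap.range_comp, Submodule.range_subtype]

/-- **The computed rank is the rank of the linear-part matrix.** For `P : PolyMapF2 n`,
`rank` of its untyped presentation — the `F₂`-rank of the parity matrix restricted to the columns
`vars` (all variable occurrences, with repetitions) — equals the rank of the full `m × n` matrix
`(#{[j] in Pᵢ} mod 2)ᵢⱼ`: every row of the full matrix is supported on occurring variables, so the
restriction of coordinates is injective on the row space. [DvirGutfreundRothblumVadhan2010, §1 p. 1]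
[cite: DvirGutfreundRothblumVadhan2010, §1 p.1] -/
theorem rank_untyped_eq (P : PolyMapF2 n) :
    rank (P.map (List.map (List.map Fin.val))) =
      (Matrix.of fun (i : Fin P.length) (j : Fin n) => (((P.get i).count [j] : ℕ) : ZMod 2)).rank := by
  classical
  set PT := P.map (List.map (List.map Fin.val)) with hPT
  set A : Matrix (Fin P.length) (Fin n) (ZMod 2) :=
    Matrix.of fun (i : Fin P.length) (j : Fin n) => (((P.get i).count [j] : ℕ) : ZMod 2) with hA
  set N := (vars PT).length with hN
  -- the column selection along the occurring variables
  let vs' : Fin N → Fin n := fun t => ⟨(vars PT).get t, vars_lt (List.get_mem (vars PT) t)⟩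
  let φ : (Fin n → ZMod 2) →ₗ[ZMod 2] (Fin N → ZMod 2) := LinearMap.funLeft (ZMod 2) (ZMod 2) vs'
  have hlen : (rows PT).length = P.length := by rw [length_rows, hPT, List.length_map]
  -- Step 1: the list rank is the dimension of the span of the computed rows
  have h1 := GaussRank.lrank_eq_finrank_span (rows PT) fun r hr => length_of_mem_rows hr
  -- Step 2: the computed rows are the selected columns of the rows of `A`
  have hrowφ : ∀ i : Fin P.length,
      (fun k : Fin N => ((rows PT).getD (Fin.cast hlen.symm i) []).getD k 0) = φ (A.row i) := by
    intro i
    funext k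
    rw [LinearMap.funLeft_apply]
    change ((rows PT).getD i []).getD k 0 = A i (vs' k)
    rw [hA, Matrix.of_apply]
    exact getD_getD_rows P i k.isLt (vs' k) rfl
  have h2 : (Set.range fun i : Fin (rows PT).length => fun k : Fin N => ((rows PT).getD i []).getD k 0) =
      φ '' Set.range A.row := by
    ext x
    simp only [Set.mem_range, Set.mem_image, exists_exists_eq_and]
    constructor
    · rintro ⟨i, rfl⟩
      exact ⟨Fin.cast hlen i, (hrowφ (Fin.cast hlen i)).symm⟩
    · rintro ⟨i, rfl⟩
      exact ⟨Fin.cast hlen.symm i, hrowφ i⟩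
  -- Step 3: rows of `A` (hence their span) are supported on occurring variables
  have hsupp : ∀ x ∈ Submodule.span (ZMod 2) (Set.range A.row), ∀ j : Fin n,
      (∀ t : Fin N, vs' t ≠ j) → x j = 0 := by
    intro x hx
    induction hx using Submodule.span_induction with
    | mem x hx =>
      obtain ⟨i, rfl⟩ := hx
      intro j hj
      change A i j = 0
      rw [hA, Matrix.of_apply]
      have hcount : (P.get i).count [j] = 0 := by
        rw [List.count_eq_zero]
        intro hmem
        obtain ⟨t, ht⟩ := List.get_of_mem (val_mem_vars hmem)
        exact hj t (Fin.ext ht)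
      rw [hcount, Nat.cast_zero]
    | zero => intro j _; rfl
    | add x y _ _ hx hy => intro j hj; rw [Pi.add_apply, hx j hj, hy j hj, add_zero]
    | smul a x _ hx => intro j hj; rw [Pi.smul_apply, hx j hj, smul_zero]
  have hker : ∀ x ∈ Submodule.span (ZMod 2) (Set.range A.row), φ x = 0 → x = 0 := by
    intro x hx hφ
    funext j
    by_cases hj : ∃ t : Fin N, vs' t = j
    · obtain ⟨t, rfl⟩ := hj
      have := congrFun hφ t
      rwa [LinearMap.funLeft_apply] at this
    · push Not at hj
      exact hsupp x hx j hj
  -- Step 4: assemble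
  rw [rank, h1, h2, Submodule.span_image, finrank_map_eq_of_forall_eq_zero φ _ hker,
    Matrix.rank_eq_finrank_span_row]

end PEADegOne

end Literature.Computability.Complexity
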